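import Summits.AtomisticToContinuum.HydrodynamicLimit.Theorems.InformationPercolationEnginePercolationClosesChaosForecastDefs
import Summits.AtomisticToContinuum.HydrodynamicLimit.Theorems.LambertianContactSwapSwapGapGibbsDomination
import Literature.Probability.Divergences.EntropyEventBound
import HarnessLib

/-!
# Local equilibrium S5 of the line `equilibrium-forecast-chain-rule` (crux `InformationPercolationEngine.PercolationClosesChaos`,
stmt-AtomisticToContinuum-15178) — piece T: the large-deviation event transfer `G_N → LG` in the line's currency

Support file (`--supports stmt-AtomisticToContinuum-15178`) of the registered stub
`stub_cesaroLocalEquilibrium : PredictableProjection → MesoConditionalEquidistribution → LocalCountUI →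
NoMesoscopicOscillation → CoarseLocalMaxwellianity` (worker S5 of lead c3), equally consumed by the transfer S6.
`MesoConditionalEquidistribution` (v2, LD form) bounds the INVARIANT-law probability of the event "the unit-fraction of
forecast-bad units exceeds `δ'`" by `e^{-L(N+1)}`; S5/S6 need its probability under the EVOLVED local Gibbs law
`LG = localGibbsLaw σ a₀ u₀ θ₀ N Φ`. The lever is the entropy inequality for events (Kipnis–Landim 1999, App. 1,
Prop. 8.2; tree `Literature.Probability.Divergences.toReal_measure_le_of_klDiv_le`) together with the pinned entropy budget
`KL(LG ‖ G_N) ≤ A(N+1)` of `LambertianContactSwapSwapGapGibbsDomination.exists_localGibbsLaw_dominated`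
(`eqLaw σ N Φ` IS `localGibbsLaw σ 1 0 1 N Φ` by `rfl`). This file packages it in the form the stubs consume:

* `toReal_measure_le_of_klDiv_le'` — the event transfer for an ARBITRARY set (no measurability: through
  `toMeasurable`), `ν E ≤ e^{-G}`, `KL(μ‖ν) ≤ H` ⇒ `μ E ≤ (log 2 + H)/G`;
* `integral_le_add_mul_measureReal` — the Markov-complement step `∫ f dμ ≤ δ' + M · μ{δ' < f}` for `0 ≤ f ≤ M`
  (no measurability of `f` either: a non-integrable `f` has Bochner integral `0`);
* `log_two_add_mul_div_le` — the arithmetic `(log 2 + A(N+1))/(L(N+1)) ≤ (log 2 + A)/L`;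
* `exists_lgTransferConst` (registered helper, the headline) — for continuous positive profiles and `σ ≤ 1/2` ONE
  constant `A ≥ 0` such that for every `N`, `Φ`: `KL(LG ‖ eqLaw) ≤ A(N+1)` (the budget `PredictableProjection` spends),
  `E_LG[configEnergy] ≤ A(N+1)` with integrability (the velocity-tail input of the bin reconstruction), and for every
  set `E` and `L > 0`: `eqLaw E ≤ e^{-L(N+1)}` ⇒ `LG(E) ≤ (log 2 + A)/L`; and for `0 ≤ f ≤ M` with
  `eqLaw{δ' < f} ≤ e^{-L(N+1)}`: `∫ f dLG ≤ δ' + M (log 2 + A)/L` — uniformly in `N`.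

## References
* C. Kipnis, C. Landim, *Scaling Limits of Interacting Particle Systems* (1999), Appendix 1, Prop. 8.2.
* H.-T. Yau, Lett. Math. Phys. 22 (1991) (relative entropy method: rare under the reference law + entropy `O(N)` ⇒
  rare under the true law).
-/

noncomputable section

open MeasureTheory Set Filter Topology
open scoped ENNReal BigOperators Classical
open Literature.Analysis.FluidPDE Literature.MathematicalPhysics.KineticTheory
open Literature.MathematicalPhysics.KineticTheory.VelocityBlindPlacement

namespace Summit.AtomisticToContinuum.HydrodynamicLimit.Theorems.EquilibriumForecastLine

/-! ## The abstract transfer, for arbitrary sets and functions -/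

/-- **Entropy inequality for an arbitrary event.** For probability measures `μ, ν` with `KL(μ‖ν) ≤ H` and ANY set `E`
with `ν E ≤ e^{-G}`, `G > 0`: `μ E ≤ (log 2 + H)/G` (the measurable case
`Literature.Probability.Divergences.toReal_measure_le_of_klDiv_le` applied to `toMeasurable ν E ⊇ E`, which has the same
`ν`-measure). [cite: KipnisLandim1999, Appendix 1 Prop. 8.2 (p. 338)] -/
theorem toReal_measure_le_of_klDiv_le' {Ω : Type*} [MeasurableSpace Ω] (μ ν : Measure Ω) [IsProbabilityMeasure μ]
    [IsProbabilityMeasure ν] (E : Set Ω) {G H : ℝ} (hG : 0 < G) (hH : 0 ≤ H)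
    (hE : ν E ≤ ENNReal.ofReal (Real.exp (-G))) (hKL : InformationTheory.klDiv μ ν ≤ ENNReal.ofReal H) :
    (μ E).toReal ≤ (Real.log 2 + H) / G := by
  have hE' : ν (toMeasurable ν E) ≤ ENNReal.ofReal (Real.exp (-G)) := by rwa [measure_toMeasurable]
  have h := Literature.Probability.Divergences.toReal_measure_le_of_klDiv_le μ ν (measurableSet_toMeasurable ν E)
    hG hH hE' hKL
  exact (ENNReal.toReal_mono (measure_ne_top μ _) (measure_mono (subset_toMeasurable ν E))).trans h

/-- **Markov-complement step, junk-tolerant.** For a probability measure `μ`, `0 ≤ δ'`, `0 ≤ M` and ANY `f` with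
`0 ≤ f ≤ M`: `∫ f dμ ≤ δ' + M · μ{δ' < f}` (pointwise `f ≤ δ' + M · 𝟙_S` for the measurable hull `S` of `{δ' < f}`;
`integral_mono_of_nonneg` needs no integrability of `f`). [folklore] -/
theorem integral_le_add_mul_measureReal {Ω : Type*} [MeasurableSpace Ω] (μ : Measure Ω) [IsProbabilityMeasure μ]
    (f : Ω → ℝ) {δ' M : ℝ} (hδ' : 0 ≤ δ') (hM : 0 ≤ M) (hf0 : ∀ x, 0 ≤ f x) (hfM : ∀ x, f x ≤ M) :
    ∫ x, f x ∂μ ≤ δ' + M * (μ {x | δ' < f x}).toReal := by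
  set S := toMeasurable μ {x | δ' < f x} with hS
  have hSm : MeasurableSet S := measurableSet_toMeasurable μ _
  have hsub : {x | δ' < f x} ⊆ S := subset_toMeasurable μ _
  have hle : ∀ x, f x ≤ δ' + S.indicator (fun _ => M) x := by
    intro x
    by_cases hx : δ' < f x
    · rw [Set.indicator_of_mem (hsub hx)]
      linarith [hfM x]
    · rw [not_lt] at hx
      have : 0 ≤ S.indicator (fun _ => M) x := Set.indicator_nonneg (fun _ _ => hM) x
      linarith
  have hint : Integrable (fun x => δ' + S.indicator (fun _ => M) x) μ :=
    (integrable_const δ').add ((integrable_const M).indicator hSm)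
  calc ∫ x, f x ∂μ ≤ ∫ x, δ' + S.indicator (fun _ => M) x ∂μ :=
        integral_mono_of_nonneg (Eventually.of_forall hf0) hint (Eventually.of_forall hle)
    _ = δ' + M * (μ S).toReal := by
        rw [integral_add (integrable_const δ') ((integrable_const M).indicator hSm), integral_const,
          integral_indicator_const M hSm, smul_eq_mul, smul_eq_mul, probReal_univ, one_mul, measureReal_def, mul_comm]
    _ = δ' + M * (μ {x | δ' < f x}).toReal := by rw [hS, measure_toMeasurable]

/-- The arithmetic of the transfer at LD speed `L(N+1)`: `(log 2 + A(N+1))/(L(N+1)) ≤ (log 2 + A)/L` for `L > 0`.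
[folklore] -/
theorem log_two_add_mul_div_le (A : ℝ) {L : ℝ} (hL : 0 < L) (N : ℕ) :
    (Real.log 2 + A * ((N : ℝ) + 1)) / (L * ((N : ℝ) + 1)) ≤ (Real.log 2 + A) / L := by
  have hn : (1 : ℝ) ≤ (N : ℝ) + 1 := by simp
  have hl2 : 0 < Real.log 2 := Real.log_pos one_lt_two
  rw [div_le_div_iff₀ (by positivity) hL]
  nlinarith [mul_nonneg hl2.le hL.le]

/-- The event transfer at LD speed `L(N+1)` with budget `A(N+1)`: `ν E ≤ e^{-L(N+1)}`, `KL(μ‖ν) ≤ A(N+1)` ⇒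
`μ E ≤ (log 2 + A)/L`, uniformly in `N`. [folklore] -/
theorem toReal_measure_le_of_klDiv_le_linear {Ω : Type*} [MeasurableSpace Ω] (μ ν : Measure Ω)
    [IsProbabilityMeasure μ] [IsProbabilityMeasure ν] (E : Set Ω) {A L : ℝ} (hA : 0 ≤ A) (hL : 0 < L) (N : ℕ)
    (hE : ν E ≤ ENNReal.ofReal (Real.exp (-(L * ((N : ℝ) + 1)))))
    (hKL : InformationTheory.klDiv μ ν ≤ ENNReal.ofReal (A * ((N : ℝ) + 1))) :
    (μ E).toReal ≤ (Real.log 2 + A) / L :=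
  (toReal_measure_le_of_klDiv_le' μ ν E (by positivity) (by positivity) hE hKL).trans (log_two_add_mul_div_le A hL N)

/-- The in-mean transfer: `0 ≤ f ≤ M`, `ν{δ' < f} ≤ e^{-L(N+1)}`, `KL(μ‖ν) ≤ A(N+1)` ⇒
`∫ f dμ ≤ δ' + M (log 2 + A)/L`. [folklore] -/
theorem integral_le_of_measure_le_exp {Ω : Type*} [MeasurableSpace Ω] (μ ν : Measure Ω)
    [IsProbabilityMeasure μ] [IsProbabilityMeasure ν] (f : Ω → ℝ) {δ' M A L : ℝ} (hδ' : 0 ≤ δ') (hM : 0 ≤ M)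
    (hf0 : ∀ x, 0 ≤ f x) (hfM : ∀ x, f x ≤ M) (hA : 0 ≤ A) (hL : 0 < L) (N : ℕ)
    (hE : ν {x | δ' < f x} ≤ ENNReal.ofReal (Real.exp (-(L * ((N : ℝ) + 1)))))
    (hKL : InformationTheory.klDiv μ ν ≤ ENNReal.ofReal (A * ((N : ℝ) + 1))) :
    ∫ x, f x ∂μ ≤ δ' + M * ((Real.log 2 + A) / L) := by
  have h1 := integral_le_add_mul_measureReal μ f hδ' hM hf0 hfM
  have h2 := toReal_measure_le_of_klDiv_le_linear μ ν {x | δ' < f x} hA hL N hE hKL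
  nlinarith

/-! ## The transfer constants of the line -/

/-- **Registered helper `exists_lgTransferConst` (piece T of S5/S6): the entropy budget, the energy budget and the LD event
transfer `G_N → LG`, with ONE constant.** For continuous positive profiles and `σ ≤ 1/2` there is `A ≥ 0` such that for
every `N` and every flow `Φ`, with `LG = localGibbsLaw σ a₀ u₀ θ₀ N Φ` and `G_N = eqLaw σ N Φ`:
`KL(LG ‖ G_N) ≤ A(N+1)`; `configEnergy` is `LG`-integrable with `E_LG[configEnergy] ≤ A(N+1)`; for every set `E` and
`L > 0`, `G_N(E) ≤ e^{-L(N+1)}` ⇒ `LG(E) ≤ (log 2 + A)/L`; and for every `f` with `0 ≤ f ≤ M`, `δ' ≥ 0`, `L > 0`,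
`G_N{δ' < f} ≤ e^{-L(N+1)}` ⇒ `∫ f dLG ≤ δ' + M (log 2 + A)/L`. [folklore] -/
theorem exists_lgTransferConst : ∀ {a₀ θ₀ : T3 → ℝ} {u₀ : T3 → V3}, Continuous a₀ → Continuous θ₀ → Continuous u₀ → (∀ x, 0 < a₀ x) → (∀ x, 0 < θ₀ x) → ∀ {σ : ℝ}, σ ≤ 1 / 2 → ∃ A : ℝ, 0 ≤ A ∧ ∀ (N : ℕ) (Φ : Flow σ N), InformationTheory.klDiv (localGibbsLaw σ a₀ u₀ θ₀ N Φ) (eqLaw σ N Φ) ≤ ENNReal.ofReal (A * ((N : ℝ) + 1)) ∧ Integrable (fun z : Phase N => configEnergy z) (localGibbsLaw σ a₀ u₀ θ₀ N Φ) ∧ ∫ z, configEnergy z ∂(localGibbsLaw σ a₀ u₀ θ₀ N Φ) ≤ A * ((N : ℝ) + 1) ∧ (∀ (E : Set (Phase N)) (L : ℝ), 0 < L → eqLaw σ N Φ E ≤ ENNReal.ofReal (Real.exp (-(L * ((N : ℝ) + 1)))) → (localGibbsLaw σ a₀ u₀ θ₀ N Φ E).toReal ≤ (Real.log 2 + A)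 / L) ∧ (∀ (f : Phase N → ℝ) (δ' M L : ℝ), 0 ≤ δ' → 0 ≤ M → (∀ z, 0 ≤ f z) → (∀ z, f z ≤ M) → 0 < L → eqLaw σ N Φ {z | δ' < f z} ≤ ENNReal.ofReal (Real.exp (-(L * ((N : ℝ) + 1)))) → ∫ z, f z ∂(localGibbsLaw σ a₀ u₀ θ₀ N Φ) ≤ δ' + M * ((Real.log 2 + A) / L)) := by
  intro a₀ θ₀ u₀ ha hθ hu ha0 hθ0 σ hσ2
  obtain ⟨A, b, hA, -, hdom⟩ :=
    LambertianContactSwapSwapGapGibbsDomination.exists_localGibbsLaw_dominated ha hθ hu ha0 hθ0 hσ2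
  refine ⟨A, hA, fun N Φ => ?_⟩
  obtain ⟨-, -, hkl, hint, hener⟩ := hdom N Φ
  haveI : IsProbabilityMeasure (localGibbsLaw σ a₀ u₀ θ₀ N Φ) :=
    isProbabilityMeasure_localGibbsLaw ha hθ hu ha0 hθ0 hσ2 N Φ
  haveI : IsProbabilityMeasure (eqLaw σ N Φ) :=
    isProbabilityMeasure_localGibbsLaw (a₀ := fun _ => (1 : ℝ)) (θ₀ := fun _ => (1 : ℝ)) (u₀ := fun _ => (0 : V3))
      continuous_const continuous_const continuous_const (fun _ => one_pos) (fun _ => one_pos) hσ2 N Φ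
  have hkl' : InformationTheory.klDiv (localGibbsLaw σ a₀ u₀ θ₀ N Φ) (eqLaw σ N Φ) ≤
      ENNReal.ofReal (A * ((N : ℝ) + 1)) := hkl
  refine ⟨hkl', hint, hener, fun E L hL hE => ?_, fun f δ' M L hδ' hM hf0 hfM hL hE => ?_⟩
  · exact toReal_measure_le_of_klDiv_le_linear _ _ E hA hL N hE hkl'
  · exact integral_le_of_measure_le_exp _ _ f hδ' hM hf0 hfM hA hL N hE hkl'

end Summit.AtomisticToContinuum.HydrodynamicLimit.Theorems.EquilibriumForecastLine

end
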